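import Summits.ValiantsHypothesis.ValiantsHypothesis.Theorems.LacunarySymmetroidMatrixDescartesNsdPivotBlockSum

/-!
# `MatrixDescartes` (stmt-ValiantsHypothesis-18050) — NSD-pivot counts at ODD sizes and the all-sizes statement:
# every `n ≥ 2` carries an `n × n` pivot pencil with `J ⪯ 0`, four PSD letters and `≥ 4n − 2 > 2n` positive roots

HONEST FRAMING.  Cell `pub-symmetroid`, seat `val-sym-mdr-p2` (gen 11); helper file `--supports` the crux
`Theses.LacunarySymmetroid.MatrixDescartes` (OPEN), NO closure claim.  Companion of `…NsdPivotBlockSum` (even sizes: `4n` with four letters,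
`Pivot.NsdBlockSum.superadditive`).  Here a `1 × 1` generator on the same support `(20; 21, 19, 0, 40)` with TWO positive roots
(`−3X²⁰ + X¹⁹ + X²¹ = X¹⁹(1 − 3X + X²)`, roots `(3 ± √5)/2`) is added as the odd block: size `2j + 1` carries `≥ 8j + 2` roots
(**`exists_nsd_four_letters_odd`**), so for EVERY `n ≥ 2` some `n × n` NSD-pivot pencil with four PSD letters has `≥ 4n − 2 > 2n` distinct
positive determinant roots (**`exists_nsd_four_letters_all`**, **`not_nsdPivotLaw_all`**): the K-free NSD-pivot law located by gen 10 fails at every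
size, not only at `n = 2`.  Nothing here bears on `MatrixDescartes` in its window, on `DoorA26` / `DoorA34`, on the cell's registers, or on `VP ≠ VNP`.

[folklore] Elementary; the tree's certificate kit at size one and `Pivot.NsdBlockSum.superadditive`.
-/

-- `Summit.ValiantsHypothesis.ValiantsHypothesis.…` repeats a component by the D-0017 layout
-- (single-conjunct summit), which the `dupNamespace` linter flags; the name is mandated.
set_option linter.dupNamespace false

namespace Summit.ValiantsHypothesis.ValiantsHypothesis.Theorems.LacunarySymmetroidMatrixDescartes.Pivot

open scoped BigOperators Matrix
open Polynomial

namespace NsdBlockSumOdd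

/-- Closed form at size one: `det (t²⁰ • (−3) + t²¹·1 + t¹⁹·1 + t⁰·0 + t⁴⁰·0) = −3t²⁰ + t²¹ + t¹⁹`. [folklore] -/
theorem eval_det_one (t : ℝ) :
    (t ^ 20 • (!![(-3 : ℝ)] : Matrix (Fin 1) (Fin 1) ℝ)
      + ∑ k, t ^ (![21, 19, 0, 40] : Fin 4 → ℕ) k •
        (![!![(1 : ℝ)], !![(1 : ℝ)], !![(0 : ℝ)], !![(0 : ℝ)]] : Fin 4 → Matrix (Fin 1) (Fin 1) ℝ) k).det
      = -(3 : ℝ) * t ^ 20 + t ^ 21 + t ^ 19 := by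
  rw [Matrix.det_fin_one]
  simp [Matrix.add_apply, Fin.sum_univ_succ]
  ring

/-- The `1 × 1` generator: pivot `−3` (NSD), letters `1, 1, 0, 0` at `21, 19, 0, 40`: two positive roots (signs `+ − +` at `3/10, 1, 3`).
[folklore] -/
theorem two_le_pivotPosRoots_one :
    2 ≤ pivotPosRoots 20 (![21, 19, 0, 40] : Fin 4 → ℕ) (!![(-3 : ℝ)] : Matrix (Fin 1) (Fin 1) ℝ)
      (![!![(1 : ℝ)], !![(1 : ℝ)], !![(0 : ℝ)], !![(0 : ℝ)]] : Fin 4 → Matrix (Fin 1) (Fin 1) ℝ) :=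
  le_pivotPosRoots_of_certificate (N := 2) eval_det_one ![3 / 10, 1, 3]
    (by
      refine Fin.strictMono_iff_lt_succ.2 fun j => ?_
      fin_cases j <;> simp only [Fin.castSucc_mk, Fin.succ_mk] <;> norm_num)
    (by intro j; fin_cases j <;> norm_num)
    (by intro j; fin_cases j <;> simp only [Fin.castSucc_mk, Fin.succ_mk] <;> norm_num)

/-- NSD attainability at size one on the support `(20; 21, 19, 0, 40)` with `A = 2`. [folklore] -/
theorem natt_one_four :
    ∃ (J : Matrix (Fin 1) (Fin 1) ℝ) (P : Fin 4 → Matrix (Fin 1) (Fin 1) ℝ),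
      J.IsSymm ∧ (∀ k, (P k).PosSemidef) ∧ (-J).PosSemidef ∧ 2 ≤ pivotPosRoots 20 (![21, 19, 0, 40] : Fin 4 → ℕ) J P := by
  refine ⟨!![(-3 : ℝ)], ![!![(1 : ℝ)], !![(1 : ℝ)], !![(0 : ℝ)], !![(0 : ℝ)]], ?_, ?_, ?_, two_le_pivotPosRoots_one⟩
  · exact Matrix.IsSymm.ext fun i j => by fin_cases i; fin_cases j; rfl
  · have h1 : (!![(1 : ℝ)] : Matrix (Fin 1) (Fin 1) ℝ) = Matrix.diagonal ![(1 : ℝ)] := by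
      ext i j; fin_cases i; fin_cases j; simp
    have h0 : (!![(0 : ℝ)] : Matrix (Fin 1) (Fin 1) ℝ) = 0 := by
      ext i j; fin_cases i; fin_cases j; simp
    have hp1 : (!![(1 : ℝ)] : Matrix (Fin 1) (Fin 1) ℝ).PosSemidef := by
      rw [h1, Matrix.posSemidef_diagonal_iff]; intro i; fin_cases i; norm_num
    have hp0 : (!![(0 : ℝ)] : Matrix (Fin 1) (Fin 1) ℝ).PosSemidef := by
      rw [h0]; exact Matrix.PosSemidef.zero
    intro k
    fin_cases k
    · exact hp1
    · exact hp1
    · exact hp0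
    · exact hp0
  · have h : -(!![(-3 : ℝ)] : Matrix (Fin 1) (Fin 1) ℝ) = Matrix.diagonal ![(3 : ℝ)] := by
      ext i j; fin_cases i; fin_cases j; simp
    rw [h, Matrix.posSemidef_diagonal_iff]
    intro i; fin_cases i; norm_num

end NsdBlockSumOdd

open NsdBlockSumOdd in
/-- **ODD SIZES**: for every `j`, some `(2j + 1) × (2j + 1)` pivot pencil with a negative semidefinite pivot letter and four PSD letters
(support `(20; 21, 19, 0, 40)`) has at least `8j + 2` distinct positive determinant roots. [folklore] -/
theorem exists_nsd_four_letters_odd (j : ℕ) :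
    ∃ (J : Matrix (Fin (j * 2 + 1)) (Fin (j * 2 + 1)) ℝ) (P : Fin 4 → Matrix (Fin (j * 2 + 1)) (Fin (j * 2 + 1)) ℝ),
      J.IsSymm ∧ (∀ k, (P k).PosSemidef) ∧ (-J).PosSemidef ∧
        j * 8 + 2 ≤ pivotPosRoots 20 (![21, 19, 0, 40] : Fin 4 → ℕ) J P :=
  NsdBlockSum.superadditive 20 _ (exists_nsd_four_letters j) natt_one_four

/-- **ALL SIZES**: for every `n ≥ 2` some `n × n` pivot pencil with a negative semidefinite pivot letter and four PSD letters has at least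
`4n − 2` distinct positive determinant roots (`4n` when `n` is even). [folklore] -/
theorem exists_nsd_four_letters_all (n : ℕ) (hn : 2 ≤ n) :
    ∃ (J : Matrix (Fin n) (Fin n) ℝ) (P : Fin 4 → Matrix (Fin n) (Fin n) ℝ),
      J.IsSymm ∧ (∀ k, (P k).PosSemidef) ∧ (-J).PosSemidef ∧
        4 * n - 2 ≤ pivotPosRoots 20 (![21, 19, 0, 40] : Fin 4 → ℕ) J P := by
  obtain ⟨j, rfl | rfl⟩ := Nat.even_or_odd' n
  · -- n = 2j
    rw [show 2 * j = j * 2 from Nat.mul_comm 2 j]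
    obtain ⟨J, P, hJ, hP, hN, h8⟩ := exists_nsd_four_letters j
    exact ⟨J, P, hJ, hP, hN, by omega⟩
  · -- n = 2j + 1
    rw [show 2 * j + 1 = j * 2 + 1 by ring]
    obtain ⟨J, P, hJ, hP, hN, h8⟩ := exists_nsd_four_letters_odd j
    exact ⟨J, P, hJ, hP, hN, by omega⟩

/-- **THE K-FREE NSD-PIVOT LAW FAILS AT EVERY SIZE `n ≥ 2`**: it is not the case that every `n × n` pivot pencil with a negative
semidefinite pivot letter and PSD letters has at most `2n` distinct positive determinant roots. [folklore] -/
theorem not_nsdPivotLaw_all (n : ℕ) (hn : 2 ≤ n) :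
    ¬ (∀ (K e : ℕ) (d : Fin K → ℕ) (J : Matrix (Fin n) (Fin n) ℝ) (P : Fin K → Matrix (Fin n) (Fin n) ℝ),
        J.IsSymm → (-J).PosSemidef → (∀ k, (P k).PosSemidef) → pivotPosRoots e d J P ≤ 2 * n) := by
  intro h
  obtain ⟨J, P, hJ, hP, hN, h4⟩ := exists_nsd_four_letters_all n hn
  have := le_trans h4 (h 4 20 _ J P hJ hN hP)
  omega

end Summit.ValiantsHypothesis.ValiantsHypothesis.Theorems.LacunarySymmetroidMatrixDescartes.Pivot
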